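import Summits.KontsevichZagierPeriods.KontsevichZagierPeriods.Theorems.UnfoldedStokesStokesGenerationStubFibrewiseCalibrationLast
import Literature.NumberTheory.Transcendental.KZProductIdeal

/-!
# `StokesGeneration` (stmt-3586), line `fibrewise_stokes`, stub S3 — III: every coordinate

The registered stub `stub_fibrewiseStokesCalibration` of the line
`Cruxes/StokesGeneration/Lines/fibrewise_stokes.lean` (S3, reshaped by the lead to fibrewise
CONTINUOUS primitives): **every fibrewise Stokes element
`[[0,1]^{M'}, D − (G|_{xᵢ=1} − G|_{xᵢ=0})]` is a relation of the four-move calculus**, for EVERY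
coordinate `i`. Reduction to the last coordinate (file II, `of_mem_relations_fibStokes_last`) by the
coordinate transposition `(i last)`: reindexing a representation along a permutation is a
change-of-variables move (`KZ.of_sub_of_reindex_mem_relations`, rule (2) with a permutation
matrix), and all fibrewise data transport along it. This generalises the landed
`stub_cubeCalibration` (p97569: `G` of class `C¹` near the closed cube) to kinked primitives.
[Kontsevich–Zagier 2001, §1.2, rules (1)–(3)]
-/

noncomputable section

set_option linter.dupNamespace false

namespace Summit.KontsevichZagierPeriods.KontsevichZagierPeriods.Cruxes.StokesGeneration.FibrewiseStokes

open MeasureTheory Set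
open Literature.ModelTheory.ExponentialFields (IsSemialgebraic)
open Literature.NumberTheory.Transcendental
open Literature.NumberTheory.Transcendental.KZ
open Summit.KontsevichZagierPeriods.KontsevichZagierPeriods.StokesGenerationLine (isSemialgebraic_cubePi)

/-- The closed cube is invariant under relabelling coordinates. [folklore] -/
theorem setOf_comp_perm_mem_cubePi {k : ℕ} (e : Equiv.Perm (Fin k)) :
    {w : Fin k → ℝ | (fun j => w (e j)) ∈ Set.pi Set.univ (fun _ : Fin k => Set.Icc (0:ℝ) 1)} =
      Set.pi Set.univ (fun _ : Fin k => Set.Icc (0:ℝ) 1) := by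
  ext w
  simp only [mem_setOf_eq, Set.mem_univ_pi]
  exact ⟨fun h j => by simpa using h (e.symm j), fun h j => h (e j)⟩

/-- **A fibrewise Stokes element along any coordinate is a relation** (transport to the last
coordinate by the transposition `(i last)`, then `of_mem_relations_fibStokes_last`).
[cite: KontsevichZagier2001, §1.2 rules (1),(2),(3)] -/
theorem of_mem_relations_fibStokes {k : ℕ} (i : Fin (k + 1)) (G D : (Fin (k + 1) → ℝ) → ℝ)
    (K : Set (Fin (k + 1) → ℝ))
    (hG : IsSemialgebraicFunOn ℚ (Set.pi Set.univ (fun _ : Fin (k + 1) => Set.Icc (0:ℝ) 1)) G)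
    (hD : IsSemialgebraicFunOn ℚ (Set.pi Set.univ (fun _ : Fin (k + 1) => Set.Icc (0:ℝ) 1)) D)
    (hK : IsSemialgebraic ℚ K)
    (hB : ∃ B : ℝ, ∀ x ∈ Set.pi Set.univ (fun _ : Fin (k + 1) => Set.Icc (0:ℝ) 1), |G x| ≤ B)
    (hfin : ∀ x ∈ Set.pi Set.univ (fun _ : Fin (k + 1) => Set.Icc (0:ℝ) 1),
      Set.Finite {s : ℝ | Function.update x i s ∈ K})
    (hcont : ∀ x ∈ Set.pi Set.univ (fun _ : Fin (k + 1) => Set.Icc (0:ℝ) 1),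
      ContinuousOn (fun s : ℝ => G (Function.update x i s)) (Set.Icc (0:ℝ) 1))
    (hder : ∀ x ∈ Set.pi Set.univ (fun _ : Fin (k + 1) => Set.Icc (0:ℝ) 1), x ∉ K →
      x i ∈ Set.Ioo (0:ℝ) 1 → HasDerivAt (fun s : ℝ => G (Function.update x i s)) (D x) (x i))
    (q : IntegralRep (k + 1)) (hqd : q.domain = Set.pi Set.univ (fun _ : Fin (k + 1) => Set.Icc (0:ℝ) 1))
    (hqi : ∀ x ∈ Set.pi Set.univ (fun _ : Fin (k + 1) => Set.Icc (0:ℝ) 1),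
      q.integrand x = D x - (G (Function.update x i 1) - G (Function.update x i 0))) :
    of q ∈ relations := by
  classical
  set Q : Set (Fin (k + 1) → ℝ) := Set.pi Set.univ (fun _ : Fin (k + 1) => Set.Icc (0:ℝ) 1) with hQ
  -- the transposition `(i last)` and the transported data
  set e : Equiv.Perm (Fin (k + 1)) := Equiv.swap i (Fin.last k) with he
  have hei : e i = Fin.last k := by rw [he, Equiv.swap_apply_left]
  have hesymm : e.symm (Fin.last k) = i := by rw [← hei, Equiv.symm_apply_apply]
  set H : (Fin (k + 1) → ℝ) → ℝ := fun w => G (fun j => w (e j)) with hH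
  set D' : (Fin (k + 1) → ℝ) → ℝ := fun w => D (fun j => w (e j)) with hD'
  set K' : Set (Fin (k + 1) → ℝ) := {w | (fun j => w (e j)) ∈ K} with hK'
  have hQe : {w : Fin (k + 1) → ℝ | (fun j => w (e j)) ∈ Q} = Q := setOf_comp_perm_mem_cubePi e
  have hmemQ : ∀ w : Fin (k + 1) → ℝ, w ∈ Q → (fun j => w (e j)) ∈ Q := fun w hw => by
    have : w ∈ {w : Fin (k + 1) → ℝ | (fun j => w (e j)) ∈ Q} := by rw [hQe]; exact hw
    exact this
  have hupd : ∀ (w : Fin (k + 1) → ℝ) (c : ℝ),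
      (fun j => Function.update w (Fin.last k) c (e j)) = Function.update (fun j => w (e j)) i c := by
    intro w c
    funext j
    rw [Function.update_apply_equiv_apply, hesymm]
    rfl
  have hH' : IsSemialgebraicFunOn ℚ Q H := by simpa only [hQe] using hG.comp_equiv e
  have hD'' : IsSemialgebraicFunOn ℚ Q D' := by simpa only [hQe] using hD.comp_equiv e
  have hK'sa : IsSemialgebraic ℚ K' := hK.preimage_comp e
  have hB' : ∃ B : ℝ, ∀ w ∈ Q, |H w| ≤ B := by
    obtain ⟨B, hB⟩ := hB
    exact ⟨B, fun w hw => hB _ (hmemQ w hw)⟩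
  have hfin' : ∀ w ∈ Q, Set.Finite {s : ℝ | Function.update w (Fin.last k) s ∈ K'} := by
    intro w hw
    have h := hfin _ (hmemQ w hw)
    refine h.subset fun s hs => ?_
    simp only [mem_setOf_eq, hK'] at hs ⊢
    rwa [← hupd]
  have hcont' : ∀ w ∈ Q, ContinuousOn (fun s : ℝ => H (Function.update w (Fin.last k) s)) (Set.Icc (0:ℝ) 1) := by
    intro w hw
    have h := hcont _ (hmemQ w hw)
    simpa only [hH, hupd] using h
  have hder' : ∀ w ∈ Q, w ∉ K' → w (Fin.last k) ∈ Set.Ioo (0:ℝ) 1 →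
      HasDerivAt (fun s : ℝ => H (Function.update w (Fin.last k) s)) (D' w) (w (Fin.last k)) := by
    intro w hw hwK hwt
    have hxK : (fun j => w (e j)) ∉ K := hwK
    have hwt' : w (e i) ∈ Set.Ioo (0:ℝ) 1 := by rw [hei]; exact hwt
    have h := hder _ (hmemQ w hw) hxK hwt'
    rw [hei] at h
    simpa only [hH, hD', hupd] using h
  -- the reindexed representation is the last-coordinate element of the transported data
  have hqd' : (q.reindex e).domain = Q := by rw [IntegralRep.reindex_domain, hqd]; exact hQe
  have hqi' : ∀ w ∈ Q, (q.reindex e).integrand w =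
      D' w - (H (Function.update w (Fin.last k) 1) - H (Function.update w (Fin.last k) 0)) := by
    intro w hw
    simp only [IntegralRep.reindex_integrand, hqi _ (hmemQ w hw), hH, hD', hupd]
  have hcore := of_mem_relations_fibStokes_last H D' K' hH' hD'' hK'sa hB' hfin' hcont' hder'
    (q.reindex e) hqd' hqi'
  have key : of q = (of q - of (q.reindex e)) + of (q.reindex e) := by abel
  rw [key]
  exact relations.add_mem (of_sub_of_reindex_mem_relations q e) hcore

/-! ## The registered stub -/

/-- STUB (S3) `FibrewiseStokesCalibration` of the line `fibrewise_stokes` (reshaped: fibrewise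
CONTINUOUS primitive, kinks across a fibrewise-finite `ℚ`-semialgebraic `K` allowed): every
fibrewise Stokes element `[[0,1]^{M'}, D − (G|_{xᵢ=1} − G|_{xᵢ=0})]` lies in `KZ.relations`.
[cite: KontsevichZagier2001, §1.2 rule (3)] -/
theorem stub_fibrewiseStokesCalibration :
    ∀ (M' : ℕ) (i : Fin M') (G D : (Fin M' → ℝ) → ℝ) (K : Set (Fin M' → ℝ)),
      IsSemialgebraicFunOn ℚ (Set.pi Set.univ (fun _ : Fin M' => Set.Icc (0:ℝ) 1)) G →
        IsSemialgebraicFunOn ℚ (Set.pi Set.univ (fun _ : Fin M' => Set.Icc (0:ℝ) 1)) D →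
        IsSemialgebraic ℚ K →
        (∃ B : ℝ, ∀ x ∈ Set.pi Set.univ (fun _ : Fin M' => Set.Icc (0:ℝ) 1), |G x| ≤ B) →
        (∀ x ∈ Set.pi Set.univ (fun _ : Fin M' => Set.Icc (0:ℝ) 1), Set.Finite {s : ℝ | Function.update x i s ∈ K}) →
        (∀ x ∈ Set.pi Set.univ (fun _ : Fin M' => Set.Icc (0:ℝ) 1), ContinuousOn (fun s : ℝ => G (Function.update x i s)) (Set.Icc (0:ℝ) 1)) →
        (∀ x ∈ Set.pi Set.univ (fun _ : Fin M' => Set.Icc (0:ℝ) 1), x ∉ K → x i ∈ Set.Ioo (0:ℝ) 1 →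
          HasDerivAt (fun s : ℝ => G (Function.update x i s)) (D x) (x i)) →
      ∀ q : IntegralRep M', q.domain = Set.pi Set.univ (fun _ : Fin M' => Set.Icc (0:ℝ) 1) →
        (∀ x ∈ Set.pi Set.univ (fun _ : Fin M' => Set.Icc (0:ℝ) 1), q.integrand x = D x - (G (Function.update x i 1) - G (Function.update x i 0))) →
        of q ∈ relations := by
  intro M'
  cases M' with
  | zero => exact fun i => i.elim0
  | succ k =>
    intro i G D K hG hD hK hB hfin hcont hder q hqd hqi
    exact of_mem_relations_fibStokes i G D K hG hD hK hB hfin hcont hder q hqd hqi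

end Summit.KontsevichZagierPeriods.KontsevichZagierPeriods.Cruxes.StokesGeneration.FibrewiseStokes
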